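import Summits.QuantumFields.YangMills.Theorems.UnitScaleTiltCurvGradAxialFlat
import Summits.QuantumFields.YangMills.Theorems.UnitScaleTiltCurvGradFlatHolder
import HarnessLib

/-!
# Gauge side of the curvature HÖLDER bound: **in the complete axial gauge the plaquette field of EVERY regular configuration on `ℤ^d` is `½`-HÖLDER at scale `R` with constant
# `O(a + R·b + R²·a²)` — NO LOGARITHM** (route `UnitScaleTilt`, crux K1 «MinimiserStabilityRegPr» stmt-QuantumFields-19200; (L3′b)-GRAD row (★) «η-scale ½-Hölder modulus of the
# axial-gauge representative», piece R3′ — ★p1 g25 CHAIR WORD №4 (b) ∕ ★★OWNER RULING №35-B, 2026-08-30; docks px19 g12's holonomy ladder ✓`LadderHolonomyModulus` and torus transfer)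

Cell `ym3-torus` (HUMAN RULING D-0037; rung R3 = SU(2) YM₃ on T³ — NOT d = 4, NOT infinite volume, NOT a mass gap, NOT Clay).  Width seat `ym-ust-19200-w5` (gen 14).
THEOREMS ONLY (0 `def`, 0 `sorry`, default heartbeats); `--supports stmt-QuantumFields-19200 --as helper`; count-neutral.

THE THEOREM (`norm_plaqF_axial_sub_le`, `d ≥ 1`, `𝔸` a complete normed `ℂ`-algebra with `‖1‖ = 1`, configurations with values in `U1 = {‖u‖ ≤ 1, ‖u⁻¹‖ ≤ 1}`): there is `C ≥ 0` such that
for `R ≥ 4` and every `V : ℤ^d → 𝔸ˣ` with `‖V(∂p) − 1‖ ≤ a ≤ 1` (all plaquettes) and `‖(D^{1*}_V ∂V)(b)‖ ≤ b` (all bonds, [Balaban1985RegularSpaces] (1.2)), the plaquette field of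
the COMPLETE AXIAL GAUGE `W := V^{v₀}`, `v₀ = axialFn V 0`, satisfies, for every `κ μ` and every PAIR `z, z′` with `|z_k| ≤ R`, `|z′_k − z_k| ≤ ρ₀`, `1 ≤ ρ₀`, `ρ₀ + 1 ≤ R` (px19 g12's «pair form», 05:12:44Z):
  `‖F^W_{κμ}(z′) − F^W_{κμ}(z)‖ ≤ C·(a + R·b + R²·a²)·√(ρ₀∕R)`   (same axial gauge anchored at `0` for both points).
Read at a T³ member (`a = B₃ε₁η²`, `b = B₃ε₁η³`, `R = η⁻¹ = L^{K−n}`): `a + Rb + R²a² = B₃ε₁(2 + B₃ε₁)·η²` ⟹ the gauged plaquette field is `½`-Hölder at scale `η⁻¹` with constant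
`O(ε₁η²)`, K-UNIFORMLY — the `p`-slot of px19 g12's ★`dist1_hol_ladder_translate_le`, whence (★) `‖V(b) − V(b′)‖ ≤ C·ε₁·η·(tdist·η)^{½}` after the torus pull-back
(✓`CritCurvGradLog.regPr_curvGrad_lt`'s dictionary `pull`∕`plaqF_pull`∕`covDiv_pull`).  Contrast: ★p1 g13's ✓`CurvGradAxialFlat.norm_covDeriv_plaqF_le` is the GRADIENT (CZ-endpoint) row
WITH `1 + log R` — the logarithm is exactly what the `½`-Hölder currency does not need.
PROOF.  §1–§2 of ✓`CurvGradAxialFlat` VERBATIM (the complete axial gauge `W`, lit ✓`axial_bond_bound`: `‖W(z,μ) − 1‖ ≤ |z|₁·a`; `M := F^W − 1`: `‖M‖ ≤ a`,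
`‖div₂M‖ ≤ b + d(2βa + 2a²)` with `β ≤ (5dR + 1)a` (✓`norm_div2_sub_covDiv_le`), `‖d₂M‖ ≤ 60a² + 6βa` with `β ≤ 5dR·a` (✓`norm_d2_le`, the lattice Bianchi identity of
✓`CurvGradAxialBianchi`) — on the box of radius `4R` about the CENTRE `z`, i.e. `|y| ≤ 5R`, where the anchored gauge has `‖W − 1‖ ≤ 5dR·a`), then the HÖLDER flat 2-tensor estimate
✓`CurvGradFlat.tensor_holder_le` (w5 g14, R3′-flat FILE A ✓p762152) applied to the TRANSLATED tensor `y ↦ M(y + z)` (`div₂`∕`d₂` commute with translations, §1) in place of the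
CZ-endpoint `tensor_norm_sub_le`; `a + R(M₁ + M₂) ≤ 104d²·(a + Rb + R²a²)`.
References: T. Bałaban, CMP 99 (1985) 75–102 [Balaban1985RegularSpaces] (1.1), (1.2), (1.9), (1.11); CMP 98 (1985) 17–51 [Balaban1985Averaging] pp. 24–25 (axial gauge);
M. Giaquinta (1983) [Giaquinta1984] Ch. III (Campanato ⇒ Hölder).  No sorry, standard axioms.  NOT a claim about the mass gap; nothing of (★)∕GRAD∕EX∕19200 proved here.
-/

set_option autoImplicit false

noncomputable section

open Finset
open Literature.MathematicalPhysics.QuantumFieldTheory.Balaban1983to89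
open B7Prop1Explicit (Site Letter e hol plaqWord gaugeAct axialFn U1 mem_U1 hol_mem gaugeAct_mem axialFn_mem l1 l1_add_le l1_neg
  norm_inv_sub_one_le axial_bond_bound)
open B7Eq78Linearization (conjR conjR_apply conjR_sub conjR_one)
open B8Ineq132 (plaqF covDeriv covDiv plaqF_gaugeAct covDeriv_gaugeAct norm_covDiv_gaugeAct norm_conjR)
open Literature.MathematicalPhysics.QuantumFieldTheory.LatticeForm (d₂)
open Literature.MathematicalPhysics.QuantumFieldTheory.LatticeChain (div₂)
open Summit.QuantumFields.YangMills.Theorems.CurvGradFlat (tensor_holder_le)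

namespace Summit.QuantumFields.YangMills.Theorems.CurvGradAxial

variable {d : ℕ} {𝔸 : Type*} [NormedRing 𝔸] [NormOneClass 𝔸] [NormedAlgebra ℂ 𝔸]

/-! ## §1 `div₂` and `d₂` commute with translations -/

omit [NormOneClass 𝔸] [NormedAlgebra ℂ 𝔸] in
/-- `div₂ (M(· + z)) = (div₂ M)(· + z)`. [folklore] -/
theorem div₂_comp_add (M : Site d → Fin d → Fin d → 𝔸) (z y : Site d) (k : Fin d) :
    div₂ (fun w => M (w + z)) y k = div₂ M (y + z) k := by
  simp only [div₂]
  refine Finset.sum_congr rfl fun j _ => ?_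
  rw [sub_add_eq_add_sub]

omit [NormOneClass 𝔸] [NormedAlgebra ℂ 𝔸] in
/-- `d₂ (M(· + z)) = (d₂ M)(· + z)`. [folklore] -/
theorem d₂_comp_add (M : Site d → Fin d → Fin d → 𝔸) (z y : Site d) (i j k : Fin d) :
    d₂ (fun w => M (w + z)) y i j k = d₂ M (y + z) i j k := by
  simp only [d₂, add_right_comm]

/-! ## §2 ★★★ The Hölder modulus of the axial-gauge plaquette field, pair form -/

/-- ★★★ **THE PLAQUETTE FIELD OF A REGULAR CONFIGURATION IS `½`-HÖLDER AT SCALE `R` IN THE COMPLETE AXIAL GAUGE — PAIR FORM** (`d ≥ 1`): there is `C ≥ 0` such that for `R ≥ 4`, every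
`U1`-valued configuration `V` on `ℤ^d` with `‖V(∂p) − 1‖ ≤ a ≤ 1` for all plaquettes and `‖(D^{1*}_V ∂V)_μ(y)‖ ≤ b` for all bonds, the complete axial gauge `W := V^{axialFn V 0}` ANCHORED AT `0`
satisfies `‖F^W_{κμ}(z′) − F^W_{κμ}(z)‖ ≤ C·(a + R·b + R²·a²)·√(ρ₀∕R)` for all `κ μ` and every PAIR `z, z′` with `|z_k| ≤ R`, `|z′_k − z_k| ≤ ρ₀`, `1 ≤ ρ₀`, `ρ₀ + 1 ≤ R` (both points in the
SAME gauge — plaquette differences at two points are a property of the representative).  The constant: `C = C_A·104d²`, `C_A` the flat 2-tensor Hölder constant of ✓`tensor_holder_le`.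
[cite: Balaban1985RegularSpaces, (1.1)-(1.2) p.76, (1.9) p.77; Giaquinta1984, Ch. III §2 Thm 2.2] -/
theorem norm_plaqF_axial_sub_le (hd : 1 ≤ d) : ∃ C : ℝ, 0 ≤ C ∧ ∀ (R : ℕ), 4 ≤ R →
    ∀ (V : Site d → Fin d → 𝔸ˣ), (∀ x κ, V x κ ∈ U1 𝔸) → ∀ (a b : ℝ), 0 ≤ a → a ≤ 1 →
    (∀ (y : Site d) (κ μ : Fin d), κ ≠ μ → ‖plaqF V κ μ y - 1‖ ≤ a) →
    (∀ (y : Site d) (μ : Fin d), ‖covDiv 1 V μ y‖ ≤ b) →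
    ∀ (κ μ : Fin d) (z z' : Site d) (ρ₀ : ℕ), 1 ≤ ρ₀ → ρ₀ + 1 ≤ R → (∀ k, |z k| ≤ (R : ℤ)) → (∀ k, |z' k - z k| ≤ (ρ₀ : ℤ)) →
      ‖plaqF (gaugeAct (axialFn V 0) V) κ μ z' - plaqF (gaugeAct (axialFn V 0) V) κ μ z‖ ≤ C * (a + R * b + (R : ℝ) ^ 2 * a ^ 2) * Real.sqrt ((ρ₀ : ℝ) / R) := by
  obtain ⟨C₀, hC₀, hT⟩ := tensor_holder_le (d := d) (E := 𝔸) hd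
  refine ⟨C₀ * (104 * d ^ 2), by positivity, fun R hR V hV a b ha ha1 hP hdiv κ μ z z' ρ₀ hρ₀ hρR hz hzz' => ?_⟩
  have hR1 : (1 : ℝ) ≤ R := by exact_mod_cast (show 1 ≤ R by omega)
  have hd1 : (1 : ℝ) ≤ d := by exact_mod_cast hd
  have hb0 : 0 ≤ b := (norm_nonneg _).trans (hdiv 0 κ)
  -- the complete axial gauge at `0` (verbatim ✓`norm_covDeriv_plaqF_le`)
  set u : Site d → 𝔸ˣ := axialFn V 0 with hu
  set W : Site d → Fin d → 𝔸ˣ := gaugeAct u V with hW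
  have hum : ∀ x, u x ∈ U1 𝔸 := fun x => axialFn_mem hV 0 x
  have hWm : ∀ x κ, W x κ ∈ U1 𝔸 := gaugeAct_mem hV hum
  have hWb : ∀ (x : Site d) (μ : Fin d), ‖(W x μ : 𝔸) - 1‖ ≤ l1 x * a := fun x μ => by
    have h := axial_bond_bound V hV 0 (fun z κ μ hne => hP z κ μ hne) ha x μ
    rwa [sub_zero] at h
  have hWP : ∀ (y : Site d) (κ μ : Fin d), ‖plaqF W κ μ y - 1‖ ≤ a := by
    intro y κ μ
    by_cases hκμ : κ = μ
    · subst hκμ; rw [plaqF_self, sub_self, norm_zero]; exact ha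
    · have e1 : plaqF W κ μ y - 1 = conjR (u y) (plaqF V κ μ y - 1) := by rw [conjR_sub, conjR_one, hW, plaqF_gaugeAct]
      rw [e1, norm_conjR (hum y)]; exact hP y κ μ hκμ
  have hWdiv : ∀ (y : Site d) (μ : Fin d), ‖covDiv 1 W μ y‖ ≤ b := fun y μ => by
    rw [hW, norm_covDiv_gaugeAct 1 hum]; exact hdiv y μ
  -- the flat 2-tensor, TRANSLATED to the centre `z`, and its data on the box `{|y_k| ≤ 4R}` (i.e. `|y + z| ≤ 5R`)
  set M : Site d → Fin d → Fin d → 𝔸 := fun w κ' μ' => plaqF W κ' μ' w - 1 with hM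
  set Mz : Site d → Fin d → Fin d → 𝔸 := fun y => M (y + z) with hMz
  set M₁ : ℝ := b + d * (2 * ((5 * d * R + 1) * a) * a + 2 * a ^ 2) with hM₁
  set M₂ : ℝ := 60 * a ^ 2 + 6 * (5 * d * R * a) * a with hM₂
  have hbox : ∀ y : Site d, (∀ k, |y k| ≤ 4 * (R : ℤ)) → (l1 (y + z) : ℝ) ≤ 5 * d * R := fun y hy => by
    have hyz : ∀ k, |(y + z) k| ≤ ((5 * R : ℕ) : ℤ) := fun k => by
      rw [Pi.add_apply]; push_cast; exact (abs_add_le _ _).trans (by linarith [hy k, hz k])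
    have := l1_le_of_box (d := d) (h := 5 * R) (z := y + z) hyz; push_cast at this; linarith
  have hM0' : ∀ y : Site d, (∀ k, |y k| ≤ 4 * (R : ℤ)) → ∀ κ' μ', ‖Mz y κ' μ'‖ ≤ a := fun y _ κ' μ' => hWP (y + z) κ' μ'
  have hM1' : ∀ y : Site d, (∀ k, |y k| ≤ 4 * (R : ℤ)) → ∀ μ', ‖div₂ Mz y μ'‖ ≤ M₁ := by
    intro y hy μ'
    rw [hMz, div₂_comp_add]
    have hβ : ∀ ν', ‖(W (y + z - e ν') ν' : 𝔸) - 1‖ ≤ (5 * d * R + 1) * a := fun ν' => by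
      refine (hWb _ _).trans (mul_le_mul_of_nonneg_right ?_ ha)
      have h1 : (l1 (y + z - e ν') : ℝ) ≤ l1 (y + z) + l1 (-e ν' : Site d) := by
        rw [sub_eq_add_neg]; exact_mod_cast l1_add_le (y + z) (-e ν')
      rw [l1_neg, l1_e] at h1; push_cast at h1; linarith [hbox y hy]
    have h := norm_div2_sub_covDiv_le hWm ha hWP (y + z) hβ μ'
    rw [← hM] at h
    have h2 : ‖div₂ M (y + z) μ'‖ ≤ ‖div₂ M (y + z) μ' - covDiv 1 W μ' (y + z)‖ + ‖covDiv 1 W μ' (y + z)‖ := norm_le_norm_sub_add _ _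
    rw [hM₁]; linarith [hWdiv (y + z) μ']
  have hM2' : ∀ y : Site d, (∀ k, |y k| ≤ 4 * (R : ℤ)) → ∀ i j k, ‖d₂ Mz y i j k‖ ≤ M₂ := by
    intro y hy i j k
    rw [hMz, d₂_comp_add]
    have hβ : ∀ μ', ‖(W (y + z) μ' : 𝔸) - 1‖ ≤ 5 * d * R * a := fun μ' => (hWb (y + z) μ').trans (mul_le_mul_of_nonneg_right (hbox y hy) ha)
    exact norm_d2_le hWm ha ha1 (by positivity) hWP (y + z) hβ i j k
  -- the flat HÖLDER estimate (no logarithm) at the point `z′ − z` of the translated tensor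
  have hflat := hT R hR Mz a M₁ M₂ hM0' hM1' hM2' κ μ (z' - z) ρ₀ hρ₀ hρR (fun k => by rw [Pi.sub_apply]; exact hzz' k)
  have e0 : Mz (z' - z) κ μ - Mz 0 κ μ = plaqF W κ μ z' - plaqF W κ μ z := by
    simp only [hMz, hM, sub_add_cancel, zero_add]; abel
  rw [e0] at hflat
  refine hflat.trans ?_
  -- `a + R(M₁ + M₂) ≤ 104d²·(a + Rb + R²a²)`
  have hMM : M₁ + M₂ ≤ b + 104 * d ^ 2 * R * a ^ 2 := by
    have e1 : M₁ + M₂ = b + (10 * d ^ 2 * R + 4 * d + 60 + 30 * d * R) * a ^ 2 := by rw [hM₁, hM₂]; ring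
    have hc : 10 * (d : ℝ) ^ 2 * R + 4 * d + 60 + 30 * d * R ≤ 104 * d ^ 2 * R := by
      have h1 : (d : ℝ) ≤ d ^ 2 * R := by nlinarith
      have h2 : (1 : ℝ) ≤ d ^ 2 * R := by nlinarith
      have h3 : (d : ℝ) * R ≤ d ^ 2 * R := by nlinarith
      nlinarith [h1, h2, h3]
    rw [e1]
    have := mul_le_mul_of_nonneg_right hc (sq_nonneg a)
    linarith
  have hK : a + R * (M₁ + M₂) ≤ 104 * d ^ 2 * (a + R * b + (R : ℝ) ^ 2 * a ^ 2) := by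
    have h104 : (1 : ℝ) ≤ 104 * d ^ 2 := by nlinarith
    have h1 : R * (M₁ + M₂) ≤ R * b + 104 * d ^ 2 * ((R : ℝ) ^ 2 * a ^ 2) := by
      have := mul_le_mul_of_nonneg_left hMM (by positivity : (0 : ℝ) ≤ R)
      have e2 : (R : ℝ) * (b + 104 * d ^ 2 * R * a ^ 2) = R * b + 104 * d ^ 2 * ((R : ℝ) ^ 2 * a ^ 2) := by ring
      linarith [e2]
    have h2 : a ≤ 104 * d ^ 2 * a := le_mul_of_one_le_left ha h104
    have h3 : (R : ℝ) * b ≤ 104 * d ^ 2 * (R * b) := le_mul_of_one_le_left (by positivity) h104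
    nlinarith [h1, h2, h3]
  have hS0 : 0 ≤ Real.sqrt ((ρ₀ : ℝ) / R) := Real.sqrt_nonneg _
  calc C₀ * (a + R * (M₁ + M₂)) * Real.sqrt ((ρ₀ : ℝ) / R)
      ≤ C₀ * (104 * d ^ 2 * (a + R * b + (R : ℝ) ^ 2 * a ^ 2)) * Real.sqrt ((ρ₀ : ℝ) / R) :=
        mul_le_mul_of_nonneg_right (mul_le_mul_of_nonneg_left hK hC₀) hS0
    _ = C₀ * (104 * d ^ 2) * (a + R * b + (R : ℝ) ^ 2 * a ^ 2) * Real.sqrt ((ρ₀ : ℝ) / R) := by ring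

end Summit.QuantumFields.YangMills.Theorems.CurvGradAxial

end
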